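import Mathlib
import Literature.MathematicalPhysics.KineticTheory.HardSphereEuler
import Literature.Analysis.FunctionSpaces.TorusSpaceTime
import Literature.Analysis.FluidPDE.FractionalNSPrescribedEnergyIterationLimit
import HarnessLib

/-!
# Crux `NearConstantShortTimeHL` (stmt-AtomisticToContinuum-12502), line `small-tilt-domination`:
# stub `continuousOn_derivs_of_isSmoothSpaceTimeOn`

Joint continuity on the closed slab `[0, t] × 𝕋³`, `t < T`, of a space–time field
`f : ℝ → 𝕋³ → F'` that is jointly smooth on `[0, T) × 𝕋³` (`Torus.IsSmoothSpaceTimeOn (Ico 0 T) f`),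
of its one-sided time derivative `Torus.timeDerivWithin (Ico 0 T) f` and of its spatial partial
derivatives `Torus.partialDeriv i (f r)`. The lead uses it to integrate the three log-profile rows of
a classical hard-sphere Euler solution against the empirical fields.

Route (folklore real analysis): on the time set `[0, T)`, a set of unique differentiability, the
time derivative and the partial derivatives of a jointly smooth field are again jointly smooth
(`IsSmoothSpaceTimeOn.timeDerivWithin`, `IsSmoothSpaceTimeOn.partialDeriv`, Literature
`TorusSpaceTime`); a jointly smooth field has a space–time lift continuous on `[0, T) × ℝ³`, which
descends to continuity on `[0, T) × 𝕋³` because `id × proj` is an open quotient map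
(`Torus.continuousOn_uncurry_of_continuousOn_stLift`); finally restrict to `[0, t] ⊆ [0, T)`.

No definitions, no named facts.
-/

noncomputable section

namespace Summit.AtomisticToContinuum.HydrodynamicLimit.Theorems.NearConstantShortTimeHL

open scoped BigOperators ENNReal
open MeasureTheory Set Filter
open Literature.MathematicalPhysics.KineticTheory Literature.Analysis.FluidPDE Literature.Analysis.FunctionSpaces

/-- A field jointly smooth on `S × 𝕋^d` is jointly continuous on `S' × 𝕋^d` for every `S' ⊆ S`
(continuity of the space–time lift, descended along the open quotient map `id × proj`).
[folklore] -/
theorem wd_continuousOn_uncurry_of_isSmoothSpaceTimeOn {d : Type*} [Fintype d] {F' : Type*}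
    [NormedAddCommGroup F'] [NormedSpace ℝ F'] {S S' : Set ℝ} {u : ℝ → UnitAddTorus d → F'}
    (hu : Torus.IsSmoothSpaceTimeOn S u) (hS' : S' ⊆ S) :
    ContinuousOn (Function.uncurry u) (S' ×ˢ univ) :=
  (Torus.continuousOn_uncurry_of_continuousOn_stLift hu.continuousOn_stLift).mono
    (prod_mono hS' subset_rfl)

/-- **Continuity on `[0, t] × 𝕋³`, `t < T`, of a field jointly smooth on `[0, T) × 𝕋³`, of its
one-sided time derivative within `[0, T)` and of its spatial partial derivatives** (derivatives of
jointly smooth fields are jointly smooth on time sets of unique differentiability; continuity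
descends from the lift along the open quotient map `id × proj`). [folklore] -/
theorem continuousOn_derivs_of_isSmoothSpaceTimeOn : ∀ {F' : Type*} [NormedAddCommGroup F'] [NormedSpace ℝ F'] {T t : ℝ} {f : ℝ → T3 → F'}, Torus.IsSmoothSpaceTimeOn (Set.Ico 0 T) f → t < T → ContinuousOn (Function.uncurry f) (Set.Icc 0 t ×ˢ Set.univ) ∧ ContinuousOn (fun p : ℝ × T3 => Torus.timeDerivWithin (Set.Ico 0 T) f p.1 p.2) (Set.Icc 0 t ×ˢ Set.univ) ∧ ∀ i, ContinuousOn (fun p : ℝ × T3 => Torus.partialDeriv i (f p.1) p.2) (Set.Icc 0 t ×ˢ Set.univ) := by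
  intro F' _ _ T t f hf htT
  have hS : UniqueDiffOn ℝ (Ico (0 : ℝ) T) := uniqueDiffOn_Ico 0 T
  have hIcc : Icc (0 : ℝ) t ⊆ Ico 0 T := fun r hr => ⟨hr.1, hr.2.trans_lt htT⟩
  exact ⟨wd_continuousOn_uncurry_of_isSmoothSpaceTimeOn hf hIcc,
    wd_continuousOn_uncurry_of_isSmoothSpaceTimeOn (hf.timeDerivWithin hS) hIcc,
    fun i => wd_continuousOn_uncurry_of_isSmoothSpaceTimeOn (hf.partialDeriv hS i) hIcc⟩

end Summit.AtomisticToContinuum.HydrodynamicLimit.Theorems.NearConstantShortTimeHL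

end
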